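import Summits.KontsevichZagierPeriods.KontsevichZagierPeriods.Theorems.GpcZeta4Eq4zeta31.Negative.Subcalculi

/-!
# `GpcZeta4Eq4zeta31` (stmt-KontsevichZagierPeriods-0275): negative side — the shuffle toolkit
# (dissections + coordinate permutations) does not prove `ζ(4) = 4ζ(3,1)`

Companion of `Negative/Subcalculi.lean` (cdisprove unit of the crux `GpcZeta4Eq4zeta31`, route
`Grothendieck`). The sub-calculus `permScissors = closure (domainAdd ∪ integrandAdd ∪ permCovRel)` —
dissections with null overlaps, integrand additivity, and changes of variables by COORDINATE PERMUTATIONS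
(`|det| = 1`; `permCovRel ⊆ changeOfVariablesRel`, so `permScissors ≤ KZ.relations`) — is exactly the
toolkit of the shuffle dissection (`ShuffleIsDissection`: `Δ₂ × Δ₂` into six simplices, re-ordered by
permutations). **It does not contain the target** `cFds4 = [Δ₄, ω₀₀₀₁] − [Δ₄, 4ω₀₀₁₁]`
(`target_not_mem_permScissors`): the ORBIT-WINDOW INVARIANT `J = Σ_{π ∈ S₄} windowEval (W_π)`,
`W_π = {x | x ∘ π ∈ B}` the 24 permuted copies of the box `B ⊆ Δ₄` of `LoadBearing.lean`, is additive,
kills both additivity moves, is invariant under permutation moves (re-index the orbit; the Jacobian is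
`1`), and equals `∫_B (ω₀₀₀₁ − 4ω₀₀₁₁) > 0` on the target because only the identity copy of the box meets
the ordered simplex. Consequence: every move chain for the crux uses a change of variables that is NOT a
coordinate permutation (e.g. Eie's rational substitution of line (β), the cubical monomial map of the
stuffle, a reflection `tᵢ ↦ 1 − tᵢ`), or a Newton–Leibniz move.

Sources: M. Kontsevich, D. Zagier, *Periods* (2001), §1.2 rules (1), (2).
-/

noncomputable section

namespace Summit.KontsevichZagierPeriods.GpcZeta4Eq4zeta31.Negative

open Set MeasureTheory
open Literature.NumberTheory.Transcendental
open Literature.NumberTheory.Transcendental.KZ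
open Summit.KontsevichZagierPeriods.MzvKernelInKZ.Negative
open Summit.KontsevichZagierPeriods.HoffmanRelationInKZ.Negative
  (window windowEval windowEval_of addOnly addOnly_le_ker_windowEval measurableSet_window lo₄ hi₄
    window₄_subset)

/-! ## Permutation scissors: dissections + coordinate permutations do not suffice -/

section PermScissors

variable {n : ℕ}

/-- Coordinate permutation `x ↦ x ∘ σ`. [folklore] -/
def permMap (σ : Equiv.Perm (Fin n)) (x : Fin n → ℝ) : Fin n → ℝ := x ∘ σ

/-- `(x ∘ σ) i = x (σ i)`. [folklore] -/
@[simp] theorem permMap_apply (σ : Equiv.Perm (Fin n)) (x : Fin n → ℝ) (i : Fin n) :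
    permMap σ x i = x (σ i) := rfl

/-- As a continuous linear map. [folklore] -/
def permLin (σ : Equiv.Perm (Fin n)) : (Fin n → ℝ) →L[ℝ] (Fin n → ℝ) :=
  LinearMap.toContinuousLinearMap (LinearMap.funLeft ℝ ℝ σ)

/-- The linear map is the permutation map. [folklore] -/
@[simp] theorem permLin_apply (σ : Equiv.Perm (Fin n)) (x : Fin n → ℝ) : permLin σ x = permMap σ x := rfl

/-- A coordinate permutation is its own derivative. [folklore] -/
theorem hasFDerivAt_permMap (σ : Equiv.Perm (Fin n)) (x : Fin n → ℝ) :
    HasFDerivAt (permMap σ) (permLin σ) x :=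
  (permLin σ).hasFDerivAt

/-- `σ ∘ σ⁻¹ = id` on coordinates. [folklore] -/
theorem permMap_permMap_symm (σ : Equiv.Perm (Fin n)) (x : Fin n → ℝ) :
    permMap σ (permMap σ⁻¹ x) = x := by
  funext i; simp

/-- `σ⁻¹ ∘ σ = id` on coordinates. [folklore] -/
theorem permMap_symm_permMap (σ : Equiv.Perm (Fin n)) (x : Fin n → ℝ) :
    permMap σ⁻¹ (permMap σ x) = x := by
  funext i; simp

/-- Coordinate permutations are injective. [folklore] -/
theorem injective_permMap (σ : Equiv.Perm (Fin n)) : Function.Injective (permMap σ) := fun x y h => by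
  rw [← permMap_symm_permMap σ x, ← permMap_symm_permMap σ y, h]

/-- Powers of the permutation map. [folklore] -/
theorem permLin_pow (σ : Equiv.Perm (Fin n)) (k : ℕ) :
    (permLin σ : (Fin n → ℝ) →ₗ[ℝ] (Fin n → ℝ)) ^ k = (permLin (σ ^ k) : (Fin n → ℝ) →ₗ[ℝ] (Fin n → ℝ)) := by
  induction k with
  | zero =>
    apply LinearMap.ext; intro x; funext i
    simp [permLin, LinearMap.funLeft_apply]
  | succ k ih =>
    rw [pow_succ, ih]
    apply LinearMap.ext; intro x; funext i
    simp [permLin, LinearMap.funLeft_apply, pow_succ']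

/-- `|det| = 1` for a coordinate permutation (it has finite order). [folklore] -/
theorem abs_det_permLin (σ : Equiv.Perm (Fin n)) : |(permLin σ).det| = 1 := by
  have hk : 0 < orderOf σ := orderOf_pos σ
  have h1 : (permLin σ : (Fin n → ℝ) →ₗ[ℝ] (Fin n → ℝ)) ^ orderOf σ = LinearMap.id := by
    rw [permLin_pow, pow_orderOf_eq_one]
    apply LinearMap.ext; intro x; funext i
    simp [permLin, LinearMap.funLeft_apply]
  have h2 := congrArg LinearMap.det h1
  rw [map_pow, LinearMap.det_id] at h2
  change |LinearMap.det (permLin σ : (Fin n → ℝ) →ₗ[ℝ] (Fin n → ℝ))| = 1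
  have h3 : |LinearMap.det (permLin σ : (Fin n → ℝ) →ₗ[ℝ] (Fin n → ℝ))| ^ orderOf σ = 1 := by
    rw [← abs_pow, h2, abs_one]
  exact (pow_eq_one_iff_of_nonneg (abs_nonneg _) hk.ne').1 h3

/-- The permutation map is a polynomial map over `ℚ`. [folklore] -/
theorem isSemialgebraicMapOn_permMap {s : Set (Fin n → ℝ)}
    (hs : Literature.ModelTheory.ExponentialFields.IsSemialgebraic ℚ s) (σ : Equiv.Perm (Fin n)) :
    IsSemialgebraicMapOn ℚ s (permMap σ) := by
  have h := isSemialgebraicMapOn_aeval hs (fun j : Fin n => (MvPolynomial.X (σ j) : MvPolynomial (Fin n) ℚ))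
  refine h.congr fun x _ => ?_
  funext j
  simp

/-- **Move set: change of variables by a coordinate permutation** (`|det| = 1`). -/
def permCovRel : Set FormalRep :=
  {c | ∃ (n : ℕ) (r r' : IntegralRep n) (σ : Equiv.Perm (Fin n)),
    r'.domain = permMap σ '' r.domain ∧ (∀ x ∈ r.domain, r.integrand x = r'.integrand (permMap σ x)) ∧
    c = of r - of r'}

/-- Permutation moves ARE changes of variables of the calculus. [folklore] -/
theorem permCovRel_subset_changeOfVariablesRel : permCovRel ⊆ changeOfVariablesRel := by
  rintro c ⟨n, r, r', σ, hdom, hint, rfl⟩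
  exact ⟨n, r, r', permMap σ, fun _ => permLin σ, isSemialgebraicMapOn_permMap r.isSemialgebraic_domain σ,
    fun x _ => (hasFDerivAt_permMap σ x).hasFDerivWithinAt, (injective_permMap σ).injOn, hdom,
    fun x hx => by rw [abs_det_permLin, mul_one]; exact hint x hx, rfl⟩

/-- **The permutation-scissors sub-calculus**: dissections, integrand additivity, coordinate permutations
(exactly the toolkit of the shuffle dissection `ShuffleIsDissection`). -/
def permScissors : AddSubgroup FormalRep := AddSubgroup.closure (domainAddRel ∪ integrandAddRel ∪ permCovRel)

/-- The permutation-scissors sub-calculus is part of `KZ.relations`. [folklore] -/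
theorem permScissors_le_relations : permScissors ≤ relations :=
  AddSubgroup.closure_mono (by
    rintro c ((hc | hc) | hc)
    · exact Or.inl (Or.inl (Or.inl hc))
    · exact Or.inl (Or.inl (Or.inr hc))
    · exact Or.inl (Or.inr (permCovRel_subset_changeOfVariablesRel hc)))

/-- The permuted windows `W_π = {x ∈ ℝ⁴ | x ∘ π ∈ B}` (empty in dimensions `≠ 4`). -/
def permWindow (π : Equiv.Perm (Fin 4)) (m : ℕ) : Set (Fin m → ℝ) :=
  {x | ∃ h : m = 4, (fun i : Fin 4 => x (Fin.cast h.symm (π i))) ∈ window lo₄ hi₄ 4}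

/-- In dimension 4 the permuted window is the preimage of the box. [folklore] -/
theorem permWindow_four (π : Equiv.Perm (Fin 4)) : permWindow π 4 = {x | permMap π x ∈ window lo₄ hi₄ 4} := by
  ext x
  have e : ∀ h : (4 : ℕ) = 4, (fun i : Fin 4 => x (Fin.cast h.symm (π i))) = permMap π x := fun h => by
    funext i; simp [permMap]
  constructor
  · rintro ⟨h, hx⟩
    rw [e h] at hx
    exact hx
  · intro hx
    exact ⟨rfl, by rw [e rfl]; exact hx⟩

/-- In other dimensions the permuted window is empty. [folklore] -/
theorem permWindow_of_ne (π : Equiv.Perm (Fin 4)) {m : ℕ} (hm : m ≠ 4) : permWindow π m = ∅ := by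
  ext x
  simp only [permWindow, mem_setOf_eq, mem_empty_iff_false, iff_false, not_exists]
  intro h; exact absurd h hm

/-- Permuted windows are measurable. [folklore] -/
theorem measurableSet_permWindow (π : Equiv.Perm (Fin 4)) (m : ℕ) : MeasurableSet (permWindow π m) := by
  by_cases hm : m = 4
  · subst hm
    rw [permWindow_four]
    exact (measurableSet_window lo₄ hi₄ 4).preimage (permLin π).continuous.measurable
  · rw [permWindow_of_ne π hm]; exact MeasurableSet.empty

/-- **The orbit-window invariant** `J = Σ_π windowEval (W_π)`. -/
def orbitWindowEval : FormalRep →+ ℝ := ∑ π : Equiv.Perm (Fin 4), windowEval (permWindow π)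

/-- `J c = Σ_π windowEval (W_π) c`. [folklore] -/
theorem orbitWindowEval_apply (c : FormalRep) :
    orbitWindowEval c = ∑ π : Equiv.Perm (Fin 4), windowEval (permWindow π) c := by
  simp [orbitWindowEval]

/-- `J` kills the additivity moves (each window evaluation does). [folklore] -/
theorem addOnly_le_ker_orbitWindowEval : addOnly ≤ orbitWindowEval.ker := by
  intro c hc
  rw [AddMonoidHom.mem_ker, orbitWindowEval_apply]
  refine Finset.sum_eq_zero fun π _ => ?_
  exact (AddMonoidHom.mem_ker).1 (addOnly_le_ker_windowEval (A := permWindow π) (measurableSet_permWindow π) hc)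

/-- Preimage of a permuted window under a permutation is a permuted window: `σ⁻¹(W_π) = W_{σπ}`. [folklore] -/
theorem preimage_permMap_permWindow (σ π : Equiv.Perm (Fin 4)) :
    permMap σ ⁻¹' permWindow π 4 = permWindow (σ * π) 4 := by
  rw [permWindow_four, permWindow_four]
  ext x
  simp only [mem_preimage, mem_setOf_eq]
  have : permMap π (permMap σ x) = permMap (σ * π) x := by
    funext i; simp [Equiv.Perm.mul_apply]
  rw [this]

/-- **`J` is invariant under permutation moves** (reindex the orbit). [folklore] -/
theorem orbitWindowEval_eq_zero_of_mem_permCovRel {c : FormalRep} (hc : c ∈ permCovRel) : orbitWindowEval c = 0 := by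
  obtain ⟨m, r, r', σ, hdom, hint, rfl⟩ := hc
  rw [orbitWindowEval_apply]
  by_cases hm : m = 4
  · subst hm
    simp only [map_sub, windowEval_of]
    rw [Finset.sum_sub_distrib, sub_eq_zero]
    -- ∑_π ∫_{r'.dom ∩ W_π} f' = ∑_π ∫_{r.dom ∩ W_{σπ}} f, then reindex
    have hmeas : MeasurableSet r.domain := IntegralRep.measurableSet_domain_holds r
    have key : ∀ π : Equiv.Perm (Fin 4), ∫ x in r'.domain ∩ permWindow π 4, r'.integrand x =
        ∫ x in r.domain ∩ permWindow (σ * π) 4, r.integrand x := by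
      intro π
      have hset : r'.domain ∩ permWindow π 4 = permMap σ '' (r.domain ∩ permWindow (σ * π) 4) := by
        rw [hdom, ← preimage_permMap_permWindow, Set.image_inter_preimage]
      rw [hset, integral_image_eq_integral_abs_det_fderiv_smul volume
        (hmeas.inter (measurableSet_permWindow _ 4))
        (fun x _ => (hasFDerivAt_permMap σ x).hasFDerivWithinAt) ((injective_permMap σ).injOn)]
      refine setIntegral_congr_fun (hmeas.inter (measurableSet_permWindow _ 4)) fun x hx => ?_
      rw [abs_det_permLin, one_smul, hint x hx.1]
    simp_rw [key]
    exact (Equiv.sum_comp (Equiv.mulLeft σ) (fun π => ∫ x in r.domain ∩ permWindow π 4, r.integrand x)).symm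
  · refine Finset.sum_eq_zero fun π _ => ?_
    simp [map_sub, windowEval_of, permWindow_of_ne π hm]

/-- Hence `J` kills the whole permutation-scissors sub-calculus. [folklore] -/
theorem permScissors_le_ker_orbitWindowEval : permScissors ≤ orbitWindowEval.ker := by
  refine (AddSubgroup.closure_le _).mpr ?_
  rintro c (hc | hc)
  · exact addOnly_le_ker_orbitWindowEval (AddSubgroup.subset_closure hc)
  · exact (AddMonoidHom.mem_ker).2 (orbitWindowEval_eq_zero_of_mem_permCovRel hc)

/-- A strictly increasing permutation of `Fin 4` is the identity. [folklore] -/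
theorem perm_eq_one_of_strictMono {π : Equiv.Perm (Fin 4)} (h : StrictMono π) : π = 1 := by
  revert π
  decide

/-- **Only the identity window meets the simplex**: for `π ≠ 1`, `Δ₄ ∩ W_π = ∅` (a point of `Δ₄` whose
`π`-permuted coordinates are again strictly decreasing forces `π` increasing). [folklore] -/
theorem simplex_inter_permWindow_of_ne_one {π : Equiv.Perm (Fin 4)} (hπ : π ≠ 1) :
    simplex 4 ∩ permWindow π 4 = ∅ := by
  rw [permWindow_four]
  ext x
  simp only [mem_inter_iff, mem_setOf_eq, mem_empty_iff_false, iff_false, not_and]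
  intro hx hw
  have hw' : permMap π x ∈ simplex 4 := window₄_subset hw
  apply hπ
  apply perm_eq_one_of_strictMono
  intro i j hij
  have h1 : x (π j) < x (π i) := hw'.2.2 hij
  rcases lt_trichotomy (π i) (π j) with hlt | heq | hgt
  · exact hlt
  · rw [heq] at h1
    exact absurd h1 (lt_irrefl _)
  · exact absurd (hx.2.2 hgt) (lt_asymm h1)

/-- The identity window is the box itself. [folklore] -/
theorem permWindow_one : permWindow 1 4 = window lo₄ hi₄ 4 := by
  rw [permWindow_four]
  ext x
  simp only [mem_setOf_eq]
  have : permMap 1 x = x := by funext i; simp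
  rw [this]

/-- **`J(target) = ∫_B (ω₀₀₀₁ − 4ω₀₀₁₁) > 0`.** [folklore] -/
theorem orbitWindowEval_target_pos : 0 < orbitWindowEval cFds4 := by
  rw [orbitWindowEval_apply, ← Finset.add_sum_erase _ _ (Finset.mem_univ (1 : Equiv.Perm (Fin 4)))]
  have h0 : ∑ π ∈ Finset.univ.erase (1 : Equiv.Perm (Fin 4)), windowEval (permWindow π) cFds4 = 0 := by
    refine Finset.sum_eq_zero fun π hπ => ?_
    have hπ1 : π ≠ 1 := Finset.ne_of_mem_erase hπ
    rw [cFds4_eq, map_sub, windowEval_of, windowEval_of, wordRep_domain, wordRep_domain,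
      simplex_inter_permWindow_of_ne_one hπ1]
    simp
  rw [h0, add_zero]
  have h1 : windowEval (permWindow 1) cFds4 = windowEval (window lo₄ hi₄) cFds4 := by
    rw [cFds4_eq, map_sub, map_sub, windowEval_of, windowEval_of, windowEval_of, windowEval_of, permWindow_one]
  rw [h1]
  exact windowEval_target_pos

/-- **REFUTED STRENGTHENING: the shuffle toolkit does not prove `ζ(4) = 4ζ(3,1)`.** The target is not in
the closure of dissections, integrand additivity and coordinate permutations; every move chain for the
crux uses a change of variables that is NOT a coordinate permutation, or a Newton–Leibniz move. [folklore] -/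
theorem target_not_mem_permScissors : cFds4 ∉ permScissors := fun h => by
  have h0 := permScissors_le_ker_orbitWindowEval h
  rw [AddMonoidHom.mem_ker] at h0
  exact orbitWindowEval_target_pos.ne' h0

end PermScissors

end Summit.KontsevichZagierPeriods.GpcZeta4Eq4zeta31.Negative
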